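import Summits.Ventures.YMGap.RobustBall.RobustStarDoorZdW
import Summits.Ventures.YMGap.RobustBall.MassGapOnBallZdWNumericsK100
import Summits.Ventures.YMGap.RobustBall.MassGapOnBallZdWCellMajorants
import Summits.Ventures.YMGap.RobustBall.MassGapOnBallZdWMono
import Summits.Ventures.YMGap.RobustBall.RowsSU3StarPV
import Summits.Ventures.YMGap.RobustBall.TorusRowsSU3
import Summits.Ventures.YMGap.RobustBall.TorusRowsSU2Star
import Summits.Ventures.YMGap.RobustBall.TorusRowsSU3StarW
import Summits.Ventures.YMGap.RobustBall.TorusRowsSU2StarW3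
import Summits.Ventures.YMGap.RobustBall.TorusRowsSU3StarCertifiedDim3
import HarnessLib

/-!
# Venture YMGap, track ROBUST-BALL (Y2) — crux Y2-X2-WZd, step 6b: `SU(3)` ROWS ON THE TIER-2 `ℤ⁴` BALL of the robust vertex-star door,
# HYPOTHESIS-FREE (PV-variance form: Bakry–Émery Poincaré × engine-2's Schwinger–Dyson variance), every weight `κ ≥ 1/100`

HONEST FRAMING. WHAT THIS IS: a venture file (cell `pub-ymgap`, track Y2 ROBUST-BALL, seat ds-2): the schema
`suN_massGapOnBallZdW_star_pv_gen` (tier-2 `ℤ^d` star door in variance form `massGapOnBallZdW_of_robustStar_variance` fed with the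
hypothesis-free pair `oneLinkPoincareSUN_bakryEmery` × `oneLinkVarianceBound_sd` through `pvVariance_star_inputs`, GENERAL far data)
and its `SU(3)` cells at `κ = 1/100`, `D = 1000`, `t = 10⁻⁶` (far majorants `MassGapOnBallZdWNumericsK100.lean`, `Rr = 3.46412 ≥ 2√3`),
transported to every `κ ≥ 1/100` by `MassGapOnBallZdW.of_weight_le`. CELLS `(β_W, ε)` on `MemBallZdW κ (2ε) ε` at tree coupling `β_W/9`,
HYPOTHESIS-FREE, class K: `su3_massGapOnBallZdW_starPV_<oneEighth|oneSixth|oneFifth|oneQuarter|threeTenths>` = (1 / 8, .262) (1 / 6, .211) (1 / 5, .169) (1 / 4, .102) (3 / 10, .028), each with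
`…_allWeights`. BEFORE: tier-1 (finite range) PV-variance cells `RowsSU3StarPV` b06479e46691: (1/8, .263) (1/6, .212) (1/5, .170) (1/4, .102)
(3/10, .029). WHAT THIS IS NOT: gauge invariance of the member's terms IS a hypothesis; radii/rates are door artefacts; strong-coupling
LATTICE statements; nothing about the continuum or the Millennium problem.
-/

noncomputable section

open Finset Real
open Literature.MathematicalPhysics.QuantumLattice (fundamentalRep)
open Literature.MathematicalPhysics.QuantumFieldTheory hiding ZdEdge
open Summit.QuantumFields.BalabanUV.InfraRed.StrongCouplingPoincareDoorSUN (OneLinkPoincareSUN oneLinkPoincareSUN_bakryEmery)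
open Summit.QuantumFields.BalabanUV.InfraRed.StrongCouplingVarianceDoorSUN (OneLinkVarianceBound)
open Summit.Ventures.YMGap.OneLinkVarianceSD (oneLinkVarianceBound_sd)
open Summit.Ventures.YMGap.StarResolventDim (Delta gaugeR doorPoly Delta_pos_of_door gaugeR_lt_one_of_door)

namespace Summit.Ventures.YMGap.RobustBall

variable {N : ℕ}

/-! ### The schema: every `N ≥ 2`, `ℤ⁴`, PV-variance form, general far data -/

/-- **SCHEMA, every `N ≥ 2` (instantiated for `SU(3)`), `d = 4`, PV-VARIANCE FORM with GENERAL FAR DATA**: Bakry–Émery Poincaré ×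
engine-2's hypothesis-free Schwinger–Dyson variance bound at 't Hooft coupling `x = β_W/N²` (radius `R = 6x < 1/2`), near certificate
`c ≥ E·Ks·x`, `λ ≥ E₂·Sq·ε₁` (rational majorants `q₁² ≥ 1+N²R²/4`, `Ks² ≥ (NR/2+q₁)²/(1/2−R)`, `Sq² ≥ 1/(N(1/2−R))`), `Rr ≥ 2√N`;
weight `κ > 0`, rate `0 < t ≤ κ`, box radius `D ≥ 1`, tilt exponent `τ` with abstract far majorants (`e^{−κD} ≤ Fb`, `Rr·5·Fb·ε₁ ≤ τ`,
`(e^{τ})² ≤ E2b`, `(e^{τ})²+(e^{τ})⁴ ≤ Gb`, `e^{t(2D+3)} ≤ Ab`, `e^{2t}e^{−(κ−t)D} ≤ F3b`) and the closing inequality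
`E2b·Ab·ρn + Rr·Gb·(5Fb ε₁)(Ab ρn) + 2Rr·Gb·(5F3b ε₁) ≤ ρ' < 1` ⇒ `MassGapOnBallZdW 4 N (β_W/N²) κ ε₀ ε₁`. [folklore] -/
theorem suN_massGapOnBallZdW_star_pv_gen (Kn D : ℕ) (hD : 1 ≤ D) (hN : 2 ≤ N)
    {κ t τ βW ε₀ ε₁ c lam E E₂ q₁ Ks Sq Rr ρ' E2b Gb Ab Fb F3b : ℝ} (hκ : 0 < κ) (ht : 0 < t) (htκ : t ≤ κ) (hβ0 : 0 < βW)
    (hR : βW / (N : ℝ) ^ 2 * 6 < 1 / 2) (hε₁ : 0 ≤ ε₁) (hE : Real.exp ε₀ ≤ E) (hE₂ : Real.exp (ε₀ / 2) ≤ E₂) (hq₁0 : 0 ≤ q₁)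
    (hq₁ : 1 + (N : ℝ) ^ 2 * (βW / (N : ℝ) ^ 2 * 6) ^ 2 / 4 ≤ q₁ ^ 2) (hKs0 : 0 ≤ Ks)
    (hKs : ((N : ℝ) * (βW / (N : ℝ) ^ 2 * 6) / 2 + q₁) ^ 2 / (1 / 2 - βW / (N : ℝ) ^ 2 * 6) ≤ Ks ^ 2) (hSq0 : 0 ≤ Sq)
    (hSq : 1 / ((N : ℝ) * (1 / 2 - βW / (N : ℝ) ^ 2 * 6)) ≤ Sq ^ 2) (hc : E * Ks * (βW / (N : ℝ) ^ 2) ≤ c)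
    (hlam : E₂ * Sq * ε₁ ≤ lam) (hθ1 : 6 * c + lam < 1) (hcd : doorPoly 4 c < 1)
    (hRr : 2 * Real.sqrt (N : ℝ) ≤ Rr) (hFb : Real.exp (-(κ * D)) ≤ Fb) (hτ : Rr * (5 * Fb * ε₁) ≤ τ)
    (hE2b : Real.exp τ ^ 2 ≤ E2b) (hGb : Real.exp τ ^ 2 + Real.exp τ ^ 4 ≤ Gb)
    (hAb : Real.exp (t * (((max (2 * D) 1 + 2 : ℕ) : ℝ) + 1)) ≤ Ab) (hF3b : Real.exp (2 * t) * Real.exp (-((κ - t) * D)) ≤ F3b)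
    (hclose : E2b * Ab * (gaugeR 4 c + (lam + (6 * c + lam) ^ Kn * (16 * lam)) / (1 - (6 * c + lam))) +
      Rr * Gb * (5 * Fb * ε₁) * (Ab * (gaugeR 4 c + (lam + (6 * c + lam) ^ Kn * (16 * lam)) / (1 - (6 * c + lam)))) +
      2 * Rr * Gb * (5 * F3b * ε₁) ≤ ρ')
    (hρ'1 : ρ' < 1) :
    MassGapOnBallZdW 4 N (βW / (N : ℝ) ^ 2) κ ε₀ ε₁ := by
  have hN1 : 1 ≤ N := by omega
  have hN0 : (0 : ℝ) < N := by exact_mod_cast (show 0 < N by omega)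
  set R : ℝ := βW / (N : ℝ) ^ 2 * 6 with hRdef
  have hR0 : 0 ≤ R := by positivity
  have hP := oneLinkPoincareSUN_bakryEmery hN hR
  have hV := oneLinkVarianceBound_sd hN1 R
  obtain ⟨h1, h2⟩ := pvVariance_star_inputs hN (x := βW / (N : ℝ) ^ 2) hR0 hR hε₁ (by positivity) hE hE₂ hq₁0 hq₁ hKs0 hKs hSq0 hSq
  have htN : |(N : ℝ) * (βW / (N : ℝ) ^ 2)| / N = βW / (N : ℝ) ^ 2 := by rw [abs_of_nonneg (by positivity)]; field_simp
  have hb' : |(N : ℝ) * (βW / (N : ℝ) ^ 2)| / N * (2 * (((4 : ℕ) : ℝ) - 1)) ≤ R := by rw [htN, hRdef]; norm_num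
  have hc' : Real.exp ε₀ * Real.sqrt (1 / ((N : ℝ) * (1 / 2 - R)) *
      ((N : ℝ) * ((N : ℝ) * R / 2 + Real.sqrt (1 + (N : ℝ) ^ 2 * R ^ 2 / 4)) ^ 2)) * (|(N : ℝ) * (βW / (N : ℝ) ^ 2)| / N) ≤ c := by
    rw [htN]; exact h1.trans hc
  set θ : ℝ := 6 * c + lam with hθ
  set ρn : ℝ := gaugeR 4 c + (lam + θ ^ Kn * (16 * lam)) / (1 - θ) with hρn
  have hθ' : θ = (2 * ((4 : ℕ) : ℝ) - 2) * c + lam := by rw [hθ]; push_cast; ring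
  have hρn' : ρn = gaugeR 4 c + (lam + θ ^ Kn * (4 * ((4 : ℕ) : ℝ) * lam)) / (1 - θ) := by rw [hρn]; push_cast; ring
  -- nonnegativity of the near received sum
  have hE0 : 0 ≤ E := (Real.exp_pos _).le.trans hE
  have hE20 : 0 ≤ E₂ := (Real.exp_pos _).le.trans hE₂
  have hc0 : 0 ≤ c := le_trans (by positivity) hc
  have hlam0 : 0 ≤ lam := le_trans (by positivity) hlam
  have hθ0 : 0 ≤ θ := by rw [hθ]; positivity
  have hgR : 0 ≤ gaugeR 4 c := (StarResolventDim.gaugeR_lt_one_of_door (by norm_num) hc0 hcd).1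
  have hρn0 : 0 ≤ ρn := by
    rw [hρn]; exact add_nonneg hgR (div_nonneg (add_nonneg hlam0 (by positivity)) (by linarith))
  have hRr0 : 0 ≤ Rr := le_trans (by positivity) hRr
  -- far bounds (abstract majorants)
  have hFb0 : 0 ≤ Fb := (Real.exp_pos _).le.trans hFb
  have h5 : (((4 : ℕ) : ℝ) + 1) = 5 := by norm_num
  have hfarD : (((4 : ℕ) : ℝ) + 1) * Real.exp (-(κ * D)) * ε₁ ≤ 5 * Fb * ε₁ := by
    rw [h5]; exact mul_le_mul_of_nonneg_right (mul_le_mul_of_nonneg_left hFb (by norm_num)) hε₁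
  have hfarD0 : 0 ≤ (((4 : ℕ) : ℝ) + 1) * Real.exp (-(κ * D)) * ε₁ := by positivity
  have hτb : (2 * Real.sqrt N) * ((((4 : ℕ) : ℝ) + 1) * Real.exp (-(κ * D)) * ε₁) ≤ τ :=
    le_trans (mul_le_mul hRr hfarD hfarD0 hRr0) hτ
  have hA0 : 0 ≤ Real.exp (t * (((max (2 * D) 1 + 2 : ℕ) : ℝ) + 1)) := (Real.exp_pos _).le
  have hG0 : 0 ≤ Real.exp τ ^ 2 + Real.exp τ ^ 4 := by positivity
  have hclose' : Real.exp τ ^ 2 * Real.exp (t * (((max (2 * D) 1 + 2 : ℕ) : ℝ) + 1)) * ρn +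
      (2 * Real.sqrt N) * (Real.exp τ ^ 2 + Real.exp τ ^ 4) *
        ((((4 : ℕ) : ℝ) + 1) * Real.exp (-(κ * D)) * ε₁) * (Real.exp (t * (((max (2 * D) 1 + 2 : ℕ) : ℝ) + 1)) * ρn) +
      2 * (2 * Real.sqrt N) * (Real.exp τ ^ 2 + Real.exp τ ^ 4) *
        ((((4 : ℕ) : ℝ) + 1) * Real.exp (2 * t) * Real.exp (-((κ - t) * D)) * ε₁) ≤ ρ' := by
    refine le_trans ?_ hclose
    have hT1 : Real.exp τ ^ 2 * Real.exp (t * (((max (2 * D) 1 + 2 : ℕ) : ℝ) + 1)) * ρn ≤ E2b * Ab * ρn :=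
      mul_le_mul_of_nonneg_right (mul_le_mul hE2b hAb hA0 ((pow_nonneg (Real.exp_pos _).le _).trans hE2b)) hρn0
    have hSR : (2 * Real.sqrt N) * (Real.exp τ ^ 2 + Real.exp τ ^ 4) ≤ Rr * Gb := mul_le_mul hRr hGb hG0 hRr0
    have hSR0 : 0 ≤ (2 * Real.sqrt N) * (Real.exp τ ^ 2 + Real.exp τ ^ 4) := by positivity
    have hT2 : (2 * Real.sqrt N) * (Real.exp τ ^ 2 + Real.exp τ ^ 4) *
        ((((4 : ℕ) : ℝ) + 1) * Real.exp (-(κ * D)) * ε₁) * (Real.exp (t * (((max (2 * D) 1 + 2 : ℕ) : ℝ) + 1)) * ρn) ≤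
        Rr * Gb * (5 * Fb * ε₁) * (Ab * ρn) := by
      have h2 : Real.exp (t * (((max (2 * D) 1 + 2 : ℕ) : ℝ) + 1)) * ρn ≤ Ab * ρn := mul_le_mul_of_nonneg_right hAb hρn0
      exact mul_le_mul (mul_le_mul hSR hfarD hfarD0 (hSR0.trans hSR)) h2 (by positivity)
        (mul_nonneg (hSR0.trans hSR) (by positivity))
    have hT3 : 2 * (2 * Real.sqrt N) * (Real.exp τ ^ 2 + Real.exp τ ^ 4) *
        ((((4 : ℕ) : ℝ) + 1) * Real.exp (2 * t) * Real.exp (-((κ - t) * D)) * ε₁) ≤ 2 * Rr * Gb * (5 * F3b * ε₁) := by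
      have hfar' : (((4 : ℕ) : ℝ) + 1) * Real.exp (2 * t) * Real.exp (-((κ - t) * D)) * ε₁ ≤ 5 * F3b * ε₁ := by
        rw [h5, show (5 : ℝ) * Real.exp (2 * t) * Real.exp (-((κ - t) * D)) * ε₁ =
          5 * (Real.exp (2 * t) * Real.exp (-((κ - t) * D))) * ε₁ by ring]
        exact mul_le_mul_of_nonneg_right (mul_le_mul_of_nonneg_left hF3b (by norm_num)) hε₁
      have hfar0 : 0 ≤ (((4 : ℕ) : ℝ) + 1) * Real.exp (2 * t) * Real.exp (-((κ - t) * D)) * ε₁ := by positivity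
      have h1 : 2 * (2 * Real.sqrt N) * (Real.exp τ ^ 2 + Real.exp τ ^ 4) ≤ 2 * Rr * Gb := by linarith
      exact mul_le_mul h1 hfar' hfar0 (by linarith)
    linarith
  exact massGapOnBallZdW_of_robustStar_variance (d := 4) (N := N) (by norm_num) hN1 (D := D) (Kn := Kn) hD
    (by positivity) (by positivity) hb' hP hV hε₁ hc' (h2.trans hlam) hθ' hθ1 hcd hρn' hκ ht htκ
    hτb hclose' (le_trans (by positivity) hclose') hρ'1

/-! ### The `ℤ³` twin of the schema -/

/-- **SCHEMA, every `N ≥ 2` (instantiated for `SU(3)`), `d = 3` (`ℤ³`), PV-VARIANCE FORM with GENERAL FAR DATA** (door `8c² + 6c < 1`,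
`θ = 4c + λ`, far factor `4`): Bakry–Émery Poincaré × Schwinger–Dyson variance at 't Hooft coupling `x = β_W/N²` (radius `R = 4x < 1/2`), near certificate
`c ≥ E·Ks·x`, `λ ≥ E₂·Sq·ε₁` (rational majorants `q₁² ≥ 1+N²R²/4`, `Ks² ≥ (NR/2+q₁)²/(1/2−R)`, `Sq² ≥ 1/(N(1/2−R))`), `Rr ≥ 2√N`;
weight `κ > 0`, rate `0 < t ≤ κ`, box radius `D ≥ 1`, tilt exponent `τ` with abstract far majorants (`e^{−κD} ≤ Fb`, `Rr·5·Fb·ε₁ ≤ τ`,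
`(e^{τ})² ≤ E2b`, `(e^{τ})²+(e^{τ})⁴ ≤ Gb`, `e^{t(2D+3)} ≤ Ab`, `e^{2t}e^{−(κ−t)D} ≤ F3b`) and the closing inequality
`E2b·Ab·ρn + Rr·Gb·(4Fb ε₁)(Ab ρn) + 2Rr·Gb·(4F3b ε₁) ≤ ρ' < 1` ⇒ `MassGapOnBallZdW 3 N (β_W/N²) κ ε₀ ε₁`. [folklore] -/
theorem suN_massGapOnBallZdW_dim3_star_pv_gen (Kn D : ℕ) (hD : 1 ≤ D) (hN : 2 ≤ N)
    {κ t τ βW ε₀ ε₁ c lam E E₂ q₁ Ks Sq Rr ρ' E2b Gb Ab Fb F3b : ℝ} (hκ : 0 < κ) (ht : 0 < t) (htκ : t ≤ κ) (hβ0 : 0 < βW)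
    (hR : βW / (N : ℝ) ^ 2 * 4 < 1 / 2) (hε₁ : 0 ≤ ε₁) (hE : Real.exp ε₀ ≤ E) (hE₂ : Real.exp (ε₀ / 2) ≤ E₂) (hq₁0 : 0 ≤ q₁)
    (hq₁ : 1 + (N : ℝ) ^ 2 * (βW / (N : ℝ) ^ 2 * 4) ^ 2 / 4 ≤ q₁ ^ 2) (hKs0 : 0 ≤ Ks)
    (hKs : ((N : ℝ) * (βW / (N : ℝ) ^ 2 * 4) / 2 + q₁) ^ 2 / (1 / 2 - βW / (N : ℝ) ^ 2 * 4) ≤ Ks ^ 2) (hSq0 : 0 ≤ Sq)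
    (hSq : 1 / ((N : ℝ) * (1 / 2 - βW / (N : ℝ) ^ 2 * 4)) ≤ Sq ^ 2) (hc : E * Ks * (βW / (N : ℝ) ^ 2) ≤ c)
    (hlam : E₂ * Sq * ε₁ ≤ lam) (hθ1 : 4 * c + lam < 1) (hcd : doorPoly 3 c < 1)
    (hRr : 2 * Real.sqrt (N : ℝ) ≤ Rr) (hFb : Real.exp (-(κ * D)) ≤ Fb) (hτ : Rr * (4 * Fb * ε₁) ≤ τ)
    (hE2b : Real.exp τ ^ 2 ≤ E2b) (hGb : Real.exp τ ^ 2 + Real.exp τ ^ 4 ≤ Gb)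
    (hAb : Real.exp (t * (((max (2 * D) 1 + 2 : ℕ) : ℝ) + 1)) ≤ Ab) (hF3b : Real.exp (2 * t) * Real.exp (-((κ - t) * D)) ≤ F3b)
    (hclose : E2b * Ab * (gaugeR 3 c + (lam + (4 * c + lam) ^ Kn * (12 * lam)) / (1 - (4 * c + lam))) +
      Rr * Gb * (4 * Fb * ε₁) * (Ab * (gaugeR 3 c + (lam + (4 * c + lam) ^ Kn * (12 * lam)) / (1 - (4 * c + lam)))) +
      2 * Rr * Gb * (4 * F3b * ε₁) ≤ ρ')
    (hρ'1 : ρ' < 1) :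
    MassGapOnBallZdW 3 N (βW / (N : ℝ) ^ 2) κ ε₀ ε₁ := by
  have hN1 : 1 ≤ N := by omega
  have hN0 : (0 : ℝ) < N := by exact_mod_cast (show 0 < N by omega)
  set R : ℝ := βW / (N : ℝ) ^ 2 * 4 with hRdef
  have hR0 : 0 ≤ R := by positivity
  have hP := oneLinkPoincareSUN_bakryEmery hN hR
  have hV := oneLinkVarianceBound_sd hN1 R
  obtain ⟨h1, h2⟩ := pvVariance_star_inputs hN (x := βW / (N : ℝ) ^ 2) hR0 hR hε₁ (by positivity) hE hE₂ hq₁0 hq₁ hKs0 hKs hSq0 hSq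
  have htN : |(N : ℝ) * (βW / (N : ℝ) ^ 2)| / N = βW / (N : ℝ) ^ 2 := by rw [abs_of_nonneg (by positivity)]; field_simp
  have hb' : |(N : ℝ) * (βW / (N : ℝ) ^ 2)| / N * (2 * (((3 : ℕ) : ℝ) - 1)) ≤ R := by rw [htN, hRdef]; norm_num
  have hc' : Real.exp ε₀ * Real.sqrt (1 / ((N : ℝ) * (1 / 2 - R)) *
      ((N : ℝ) * ((N : ℝ) * R / 2 + Real.sqrt (1 + (N : ℝ) ^ 2 * R ^ 2 / 4)) ^ 2)) * (|(N : ℝ) * (βW / (N : ℝ) ^ 2)| / N) ≤ c := by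
    rw [htN]; exact h1.trans hc
  set θ : ℝ := 4 * c + lam with hθ
  set ρn : ℝ := gaugeR 3 c + (lam + θ ^ Kn * (12 * lam)) / (1 - θ) with hρn
  have hθ' : θ = (2 * ((3 : ℕ) : ℝ) - 2) * c + lam := by rw [hθ]; push_cast; ring
  have hρn' : ρn = gaugeR 3 c + (lam + θ ^ Kn * (4 * ((3 : ℕ) : ℝ) * lam)) / (1 - θ) := by rw [hρn]; push_cast; ring
  -- nonnegativity of the near received sum
  have hE0 : 0 ≤ E := (Real.exp_pos _).le.trans hE
  have hE20 : 0 ≤ E₂ := (Real.exp_pos _).le.trans hE₂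
  have hc0 : 0 ≤ c := le_trans (by positivity) hc
  have hlam0 : 0 ≤ lam := le_trans (by positivity) hlam
  have hθ0 : 0 ≤ θ := by rw [hθ]; positivity
  have hgR : 0 ≤ gaugeR 3 c := (StarResolventDim.gaugeR_lt_one_of_door (by norm_num) hc0 hcd).1
  have hρn0 : 0 ≤ ρn := by
    rw [hρn]; exact add_nonneg hgR (div_nonneg (add_nonneg hlam0 (by positivity)) (by linarith))
  have hRr0 : 0 ≤ Rr := le_trans (by positivity) hRr
  -- far bounds (abstract majorants)
  have hFb0 : 0 ≤ Fb := (Real.exp_pos _).le.trans hFb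
  have h5 : (((3 : ℕ) : ℝ) + 1) = 4 := by norm_num
  have hfarD : (((3 : ℕ) : ℝ) + 1) * Real.exp (-(κ * D)) * ε₁ ≤ 4 * Fb * ε₁ := by
    rw [h5]; exact mul_le_mul_of_nonneg_right (mul_le_mul_of_nonneg_left hFb (by norm_num)) hε₁
  have hfarD0 : 0 ≤ (((3 : ℕ) : ℝ) + 1) * Real.exp (-(κ * D)) * ε₁ := by positivity
  have hτb : (2 * Real.sqrt N) * ((((3 : ℕ) : ℝ) + 1) * Real.exp (-(κ * D)) * ε₁) ≤ τ :=
    le_trans (mul_le_mul hRr hfarD hfarD0 hRr0) hτ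
  have hA0 : 0 ≤ Real.exp (t * (((max (2 * D) 1 + 2 : ℕ) : ℝ) + 1)) := (Real.exp_pos _).le
  have hG0 : 0 ≤ Real.exp τ ^ 2 + Real.exp τ ^ 4 := by positivity
  have hclose' : Real.exp τ ^ 2 * Real.exp (t * (((max (2 * D) 1 + 2 : ℕ) : ℝ) + 1)) * ρn +
      (2 * Real.sqrt N) * (Real.exp τ ^ 2 + Real.exp τ ^ 4) *
        ((((3 : ℕ) : ℝ) + 1) * Real.exp (-(κ * D)) * ε₁) * (Real.exp (t * (((max (2 * D) 1 + 2 : ℕ) : ℝ) + 1)) * ρn) +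
      2 * (2 * Real.sqrt N) * (Real.exp τ ^ 2 + Real.exp τ ^ 4) *
        ((((3 : ℕ) : ℝ) + 1) * Real.exp (2 * t) * Real.exp (-((κ - t) * D)) * ε₁) ≤ ρ' := by
    refine le_trans ?_ hclose
    have hT1 : Real.exp τ ^ 2 * Real.exp (t * (((max (2 * D) 1 + 2 : ℕ) : ℝ) + 1)) * ρn ≤ E2b * Ab * ρn :=
      mul_le_mul_of_nonneg_right (mul_le_mul hE2b hAb hA0 ((pow_nonneg (Real.exp_pos _).le _).trans hE2b)) hρn0
    have hSR : (2 * Real.sqrt N) * (Real.exp τ ^ 2 + Real.exp τ ^ 4) ≤ Rr * Gb := mul_le_mul hRr hGb hG0 hRr0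
    have hSR0 : 0 ≤ (2 * Real.sqrt N) * (Real.exp τ ^ 2 + Real.exp τ ^ 4) := by positivity
    have hT2 : (2 * Real.sqrt N) * (Real.exp τ ^ 2 + Real.exp τ ^ 4) *
        ((((3 : ℕ) : ℝ) + 1) * Real.exp (-(κ * D)) * ε₁) * (Real.exp (t * (((max (2 * D) 1 + 2 : ℕ) : ℝ) + 1)) * ρn) ≤
        Rr * Gb * (4 * Fb * ε₁) * (Ab * ρn) := by
      have h2 : Real.exp (t * (((max (2 * D) 1 + 2 : ℕ) : ℝ) + 1)) * ρn ≤ Ab * ρn := mul_le_mul_of_nonneg_right hAb hρn0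
      exact mul_le_mul (mul_le_mul hSR hfarD hfarD0 (hSR0.trans hSR)) h2 (by positivity)
        (mul_nonneg (hSR0.trans hSR) (by positivity))
    have hT3 : 2 * (2 * Real.sqrt N) * (Real.exp τ ^ 2 + Real.exp τ ^ 4) *
        ((((3 : ℕ) : ℝ) + 1) * Real.exp (2 * t) * Real.exp (-((κ - t) * D)) * ε₁) ≤ 2 * Rr * Gb * (4 * F3b * ε₁) := by
      have hfar' : (((3 : ℕ) : ℝ) + 1) * Real.exp (2 * t) * Real.exp (-((κ - t) * D)) * ε₁ ≤ 4 * F3b * ε₁ := by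
        rw [h5, show (4 : ℝ) * Real.exp (2 * t) * Real.exp (-((κ - t) * D)) * ε₁ =
          4 * (Real.exp (2 * t) * Real.exp (-((κ - t) * D))) * ε₁ by ring]
        exact mul_le_mul_of_nonneg_right (mul_le_mul_of_nonneg_left hF3b (by norm_num)) hε₁
      have hfar0 : 0 ≤ (((3 : ℕ) : ℝ) + 1) * Real.exp (2 * t) * Real.exp (-((κ - t) * D)) * ε₁ := by positivity
      have h1 : 2 * (2 * Real.sqrt N) * (Real.exp τ ^ 2 + Real.exp τ ^ 4) ≤ 2 * Rr * Gb := by linarith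
      exact mul_le_mul h1 hfar' hfar0 (by linarith)
    linarith
  exact massGapOnBallZdW_of_robustStar_variance (d := 3) (N := N) (by norm_num) hN1 (D := D) (Kn := Kn) hD
    (by positivity) (by positivity) hb' hP hV hε₁ hc' (h2.trans hlam) hθ' hθ1 hcd hρn' hκ ht htκ
    hτb hclose' (le_trans (by positivity) hclose') hρ'1

/-! ### The `SU(3)` cells -/

/-- **`ℤ⁴` ROW `(β_W, ε) = (1 / 8, 0.262)`, `SU(3)`, HYPOTHESIS-FREE, TIER-2 ROBUST STAR DOOR (PV-variance form)** — ball
`MemBallZdW (1/100) (131 / 250) (131 / 500)` at tree coupling `1 / 72`: every gauge-invariant summable perturbation of `SU(3)` Wilson of ARBITRARY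
range with `e^{diam/100}`-weighted loads `(2ε, ε)` has exactly one DLR state on `ℤ⁴` and Shen–Zhu–Zhu clustering (certificate
`K_s = 1754903 / 1000000`, `S_q = 894429 / 1000000`, `c = 41163 / 1000000`, `λ = 304533 / 1000000`; `D = 1000`, `t = 10⁻⁶`; `ρ ≈ 0.9948`);
every `κ ≥ 1/100`: `su3_massGapOnBallZdW_starPV_oneEighth_allWeights`. [folklore] -/
theorem su3_massGapOnBallZdW_starPV_oneEighth : MassGapOnBallZdW 4 3 (1 / 72) (1 / 100) (131 / 250) (131 / 500) := by
  have e1 : (1 / 8 : ℝ) / ((3 : ℕ) : ℝ) ^ 2 = 1 / 72 := by norm_num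
  have h := suN_massGapOnBallZdW_star_pv_gen 20 1000 (by norm_num) (N := 3) (by norm_num) (κ := 1 / 100) (t := 1 / 1000000)
    (τ := 1 / 2500) (βW := 1 / 8) (ε₀ := 131 / 250) (ε₁ := 131 / 500) (c := 41163 / 1000000) (lam := 304533 / 1000000) (E₂ := 1299529 / 1000000)
    (q₁ := 125973 / 125000) (Ks := 1754903 / 1000000) (Sq := 894429 / 1000000) (Rr := 346412 / 100000) (ρ' := 999 / 1000)
    (E2b := 1000801 / 1000000) (Gb := 20025 / 10000) (Ab := 10021 / 10000) (Fb := 1 / 22026)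
    (F3b := (1000003 / 1000000) * ((1 / 22026) * (10011 / 10000)))
    (by norm_num) (by norm_num) (by norm_num) (by norm_num) (by norm_num) (by norm_num)
    exp_le_131_250_zdw (by rw [show (131 / 250 : ℝ) / 2 = 131 / 500 by norm_num]; exact exp_le_131_500_zdw) (by norm_num) (by norm_num) (by norm_num)
    (by norm_num) (by norm_num) (by norm_num) (by norm_num) (by norm_num) (by norm_num) (by unfold doorPoly; norm_num)
    (by rw [show ((3 : ℕ) : ℝ) = 3 by norm_num]; linarith [sqrt_three_le]) exp_neg_k100_D1000_le (by norm_num)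
    exp_tau_w4.1 exp_tau_w4.2 exp_le_A1_k100 exp_far_k100
    (by unfold gaugeR Delta; norm_num) (by norm_num)
  rw [e1] at h
  exact h

/-- The `SU(3)` row `(1 / 8, 0.262)` at EVERY weight `κ ≥ 1/100`. [folklore] -/
theorem su3_massGapOnBallZdW_starPV_oneEighth_allWeights {κ : ℝ} (hκ : 1 / 100 ≤ κ) : MassGapOnBallZdW 4 3 (1 / 72) κ (131 / 250) (131 / 500) :=
  su3_massGapOnBallZdW_starPV_oneEighth.of_weight_le hκ

/-- **`ℤ⁴` ROW `(β_W, ε) = (1 / 6, 0.211)`, `SU(3)`, HYPOTHESIS-FREE, TIER-2 ROBUST STAR DOOR (PV-variance form)** — ball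
`MemBallZdW (1/100) (211 / 500) (211 / 1000)` at tree coupling `1 / 54`: every gauge-invariant summable perturbation of `SU(3)` Wilson of ARBITRARY
range with `e^{diam/100}`-weighted loads `(2ε, ε)` has exactly one DLR state on `ℤ⁴` and Shen–Zhu–Zhu clustering (certificate
`K_s = 1892951 / 1000000`, `S_q = 462911 / 500000`, `c = 2673 / 50000`, `λ = 241239 / 1000000`; `D = 1000`, `t = 10⁻⁶`; `ρ ≈ 0.9941`);
every `κ ≥ 1/100`: `su3_massGapOnBallZdW_starPV_oneSixth_allWeights`. [folklore] -/
theorem su3_massGapOnBallZdW_starPV_oneSixth : MassGapOnBallZdW 4 3 (1 / 54) (1 / 100) (211 / 500) (211 / 1000) := by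
  have e1 : (1 / 6 : ℝ) / ((3 : ℕ) : ℝ) ^ 2 = 1 / 54 := by norm_num
  have h := suN_massGapOnBallZdW_star_pv_gen 20 1000 (by norm_num) (N := 3) (by norm_num) (κ := 1 / 100) (t := 1 / 1000000)
    (τ := 1 / 2500) (βW := 1 / 6) (ε₀ := 211 / 500) (ε₁ := 211 / 1000) (c := 2673 / 50000) (lam := 241239 / 1000000) (E₂ := 1234913 / 1000000)
    (q₁ := 202759 / 200000) (Ks := 1892951 / 1000000) (Sq := 462911 / 500000) (Rr := 346412 / 100000) (ρ' := 999 / 1000)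
    (E2b := 1000801 / 1000000) (Gb := 20025 / 10000) (Ab := 10021 / 10000) (Fb := 1 / 22026)
    (F3b := (1000003 / 1000000) * ((1 / 22026) * (10011 / 10000)))
    (by norm_num) (by norm_num) (by norm_num) (by norm_num) (by norm_num) (by norm_num)
    exp_le_211_500_zdw (by rw [show (211 / 500 : ℝ) / 2 = 211 / 1000 by norm_num]; exact exp_le_211_1000_zdw) (by norm_num) (by norm_num) (by norm_num)
    (by norm_num) (by norm_num) (by norm_num) (by norm_num) (by norm_num) (by norm_num) (by unfold doorPoly; norm_num)
    (by rw [show ((3 : ℕ) : ℝ) = 3 by norm_num]; linarith [sqrt_three_le]) exp_neg_k100_D1000_le (by norm_num)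
    exp_tau_w4.1 exp_tau_w4.2 exp_le_A1_k100 exp_far_k100
    (by unfold gaugeR Delta; norm_num) (by norm_num)
  rw [e1] at h
  exact h

/-- The `SU(3)` row `(1 / 6, 0.211)` at EVERY weight `κ ≥ 1/100`. [folklore] -/
theorem su3_massGapOnBallZdW_starPV_oneSixth_allWeights {κ : ℝ} (hκ : 1 / 100 ≤ κ) : MassGapOnBallZdW 4 3 (1 / 54) κ (211 / 500) (211 / 1000) :=
  su3_massGapOnBallZdW_starPV_oneSixth.of_weight_le hκ

/-- **`ℤ⁴` ROW `(β_W, ε) = (1 / 5, 0.169)`, `SU(3)`, HYPOTHESIS-FREE, TIER-2 ROBUST STAR DOOR (PV-variance form)** — ball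
`MemBallZdW (1/100) (169 / 500) (169 / 1000)` at tree coupling `1 / 45`: every gauge-invariant summable perturbation of `SU(3)` Wilson of ARBITRARY
range with `e^{diam/100}`-weighted loads `(2ε, ε)` has exactly one DLR state on `ℤ⁴` and Shen–Zhu–Zhu clustering (certificate
`K_s = 2014443 / 1000000`, `S_q = 119183 / 125000`, `c = 3923 / 62500`, `λ = 47701 / 250000`; `D = 1000`, `t = 10⁻⁶`; `ρ ≈ 0.9967`);
every `κ ≥ 1/100`: `su3_massGapOnBallZdW_starPV_oneFifth_allWeights`. [folklore] -/
theorem su3_massGapOnBallZdW_starPV_oneFifth : MassGapOnBallZdW 4 3 (1 / 45) (1 / 100) (169 / 500) (169 / 1000) := by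
  have e1 : (1 / 5 : ℝ) / ((3 : ℕ) : ℝ) ^ 2 = 1 / 45 := by norm_num
  have h := suN_massGapOnBallZdW_star_pv_gen 20 1000 (by norm_num) (N := 3) (by norm_num) (κ := 1 / 100) (t := 1 / 1000000)
    (τ := 1 / 2500) (βW := 1 / 5) (ε₀ := 169 / 500) (ε₁ := 169 / 1000) (c := 3923 / 62500) (lam := 47701 / 250000) (E₂ := 1184121 / 1000000)
    (q₁ := 203961 / 200000) (Ks := 2014443 / 1000000) (Sq := 119183 / 125000) (Rr := 346412 / 100000) (ρ' := 999 / 1000)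
    (E2b := 1000801 / 1000000) (Gb := 20025 / 10000) (Ab := 10021 / 10000) (Fb := 1 / 22026)
    (F3b := (1000003 / 1000000) * ((1 / 22026) * (10011 / 10000)))
    (by norm_num) (by norm_num) (by norm_num) (by norm_num) (by norm_num) (by norm_num)
    exp_le_169_500_zdw (by rw [show (169 / 500 : ℝ) / 2 = 169 / 1000 by norm_num]; exact exp_le_169_1000_zdw) (by norm_num) (by norm_num) (by norm_num)
    (by norm_num) (by norm_num) (by norm_num) (by norm_num) (by norm_num) (by norm_num) (by unfold doorPoly; norm_num)
    (by rw [show ((3 : ℕ) : ℝ) = 3 by norm_num]; linarith [sqrt_three_le]) exp_neg_k100_D1000_le (by norm_num)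
    exp_tau_w4.1 exp_tau_w4.2 exp_le_A1_k100 exp_far_k100
    (by unfold gaugeR Delta; norm_num) (by norm_num)
  rw [e1] at h
  exact h

/-- The `SU(3)` row `(1 / 5, 0.169)` at EVERY weight `κ ≥ 1/100`. [folklore] -/
theorem su3_massGapOnBallZdW_starPV_oneFifth_allWeights {κ : ℝ} (hκ : 1 / 100 ≤ κ) : MassGapOnBallZdW 4 3 (1 / 45) κ (169 / 500) (169 / 1000) :=
  su3_massGapOnBallZdW_starPV_oneFifth.of_weight_le hκ

/-- **`ℤ⁴` ROW `(β_W, ε) = (1 / 4, 0.102)`, `SU(3)`, HYPOTHESIS-FREE, TIER-2 ROBUST STAR DOOR (PV-variance form)** — ball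
`MemBallZdW (1/100) (51 / 250) (51 / 500)` at tree coupling `1 / 36`: every gauge-invariant summable perturbation of `SU(3)` Wilson of ARBITRARY
range with `e^{diam/100}`-weighted loads `(2ε, ε)` has exactly one DLR state on `ℤ⁴` and Shen–Zhu–Zhu clustering (certificate
`K_s = 1109187 / 500000`, `S_q = 1000001 / 1000000`, `c = 75567 / 1000000`, `λ = 56477 / 500000`; `D = 1000`, `t = 10⁻⁶`; `ρ ≈ 0.9989`);
every `κ ≥ 1/100`: `su3_massGapOnBallZdW_starPV_oneQuarter_allWeights`. [folklore] -/
theorem su3_massGapOnBallZdW_starPV_oneQuarter : MassGapOnBallZdW 4 3 (1 / 36) (1 / 100) (51 / 250) (51 / 500) := by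
  have e1 : (1 / 4 : ℝ) / ((3 : ℕ) : ℝ) ^ 2 = 1 / 36 := by norm_num
  have h := suN_massGapOnBallZdW_star_pv_gen 20 1000 (by norm_num) (N := 3) (by norm_num) (κ := 1 / 100) (t := 1 / 1000000)
    (τ := 1 / 2500) (βW := 1 / 4) (ε₀ := 51 / 250) (ε₁ := 51 / 500) (c := 75567 / 1000000) (lam := 56477 / 500000) (E₂ := 138423 / 125000)
    (q₁ := 515389 / 500000) (Ks := 1109187 / 500000) (Sq := 1000001 / 1000000) (Rr := 346412 / 100000) (ρ' := 999 / 1000)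
    (E2b := 1000801 / 1000000) (Gb := 20025 / 10000) (Ab := 10021 / 10000) (Fb := 1 / 22026)
    (F3b := (1000003 / 1000000) * ((1 / 22026) * (10011 / 10000)))
    (by norm_num) (by norm_num) (by norm_num) (by norm_num) (by norm_num) (by norm_num)
    exp_le_51_250_w8 (by rw [show (51 / 250 : ℝ) / 2 = 51 / 500 by norm_num]; exact exp_le_51_500_cstar3) (by norm_num) (by norm_num) (by norm_num)
    (by norm_num) (by norm_num) (by norm_num) (by norm_num) (by norm_num) (by norm_num) (by unfold doorPoly; norm_num)
    (by rw [show ((3 : ℕ) : ℝ) = 3 by norm_num]; linarith [sqrt_three_le]) exp_neg_k100_D1000_le (by norm_num)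
    exp_tau_w4.1 exp_tau_w4.2 exp_le_A1_k100 exp_far_k100
    (by unfold gaugeR Delta; norm_num) (by norm_num)
  rw [e1] at h
  exact h

/-- The `SU(3)` row `(1 / 4, 0.102)` at EVERY weight `κ ≥ 1/100`. [folklore] -/
theorem su3_massGapOnBallZdW_starPV_oneQuarter_allWeights {κ : ℝ} (hκ : 1 / 100 ≤ κ) : MassGapOnBallZdW 4 3 (1 / 36) κ (51 / 250) (51 / 500) :=
  su3_massGapOnBallZdW_starPV_oneQuarter.of_weight_le hκ

/-- **`ℤ⁴` ROW `(β_W, ε) = (3 / 10, 0.028)`, `SU(3)`, HYPOTHESIS-FREE, TIER-2 ROBUST STAR DOOR (PV-variance form)** — ball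
`MemBallZdW (1/100) (7 / 125) (7 / 250)` at tree coupling `1 / 30`: every gauge-invariant summable perturbation of `SU(3)` Wilson of ARBITRARY
range with `e^{diam/100}`-weighted loads `(2ε, ε)` has exactly one DLR state on `ℤ⁴` and Shen–Zhu–Zhu clustering (certificate
`K_s = 2453857 / 1000000`, `S_q = 527047 / 500000`, `c = 86507 / 1000000`, `λ = 30353 / 1000000`; `D = 1000`, `t = 10⁻⁶`; `ρ ≈ 0.9963`);
every `κ ≥ 1/100`: `su3_massGapOnBallZdW_starPV_threeTenths_allWeights`. [folklore] -/
theorem su3_massGapOnBallZdW_starPV_threeTenths : MassGapOnBallZdW 4 3 (1 / 30) (1 / 100) (7 / 125) (7 / 250) := by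
  have e1 : (3 / 10 : ℝ) / ((3 : ℕ) : ℝ) ^ 2 = 1 / 30 := by norm_num
  have h := suN_massGapOnBallZdW_star_pv_gen 20 1000 (by norm_num) (N := 3) (by norm_num) (κ := 1 / 100) (t := 1 / 1000000)
    (τ := 1 / 2500) (βW := 3 / 10) (ε₀ := 7 / 125) (ε₁ := 7 / 250) (c := 86507 / 1000000) (lam := 30353 / 1000000) (E₂ := 257099 / 250000)
    (q₁ := 16313 / 15625) (Ks := 2453857 / 1000000) (Sq := 527047 / 500000) (Rr := 346412 / 100000) (ρ' := 999 / 1000)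
    (E2b := 1000801 / 1000000) (Gb := 20025 / 10000) (Ab := 10021 / 10000) (Fb := 1 / 22026)
    (F3b := (1000003 / 1000000) * ((1 / 22026) * (10011 / 10000)))
    (by norm_num) (by norm_num) (by norm_num) (by norm_num) (by norm_num) (by norm_num)
    exp_le_7_125_star (by rw [show (7 / 125 : ℝ) / 2 = 7 / 250 by norm_num]; exact exp_le_7_250_w3) (by norm_num) (by norm_num) (by norm_num)
    (by norm_num) (by norm_num) (by norm_num) (by norm_num) (by norm_num) (by norm_num) (by unfold doorPoly; norm_num)
    (by rw [show ((3 : ℕ) : ℝ) = 3 by norm_num]; linarith [sqrt_three_le]) exp_neg_k100_D1000_le (by norm_num)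
    exp_tau_w4.1 exp_tau_w4.2 exp_le_A1_k100 exp_far_k100
    (by unfold gaugeR Delta; norm_num) (by norm_num)
  rw [e1] at h
  exact h

/-- The `SU(3)` row `(3 / 10, 0.028)` at EVERY weight `κ ≥ 1/100`. [folklore] -/
theorem su3_massGapOnBallZdW_starPV_threeTenths_allWeights {κ : ℝ} (hκ : 1 / 100 ≤ κ) : MassGapOnBallZdW 4 3 (1 / 30) κ (7 / 125) (7 / 250) :=
  su3_massGapOnBallZdW_starPV_threeTenths.of_weight_le hκ

end Summit.Ventures.YMGap.RobustBall

end
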